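import Summits.QuantumFields.BalabanUV.Beta.D1BFx.PeriodicArraySuperposition
import Summits.QuantumFields.BalabanUV.Beta.D1BFx.SortedEmbedding

/-!
# `BalabanUV.Beta.D1BFx.PeriodicArraySuperpositionTorus` — road «BF-x» for binder row D1, slot (K), chain step (I) «(A1)-PACKED», brick (B4c)
# «PACKED-DICT-HAT» (`A1-PACKED-SPEC.md` v0.2 §7): **THE TORUS-MATRIX FORM OF (B4)** — on every coarse torus `Site (d+1) p` with block side `n`,
# `blocksHat p (sortK n (arr (n·p) (vertexOfK K n S μ ŷ))) = Σ_{k : I d n p} r k • blocksHat p (sortK n (arr (n·p) (S κ′_k ŵ_k)))`,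
# `r k := Σ'_m colH K n μ ŷ κ′_k (ŵ_k + (n·p)·m)` the PERIODISED `ℋ`-COLUMN, `ŵ_k := windowMap (n·p) (torusBlockEquiv n p (z̄_k, ẑ_k))` the fine bond's
# window representative — i.e. the (A2-Mᴾ) DICTIONARY LETTER `hJM` of `KCombineCovStripped` for RESPONSE-PACKED data is a THEOREM: the periodised
# sorted array of the road's packed first jet IS the response-weighted finite sum of the periodised sorted arrays of the single-bond stencils.

HONEST DEPENDENCY (cell records, verbatim): «continuum YM on T⁴ ⇐ BetaPertH ∧ nine spine estimates (0/9 proved); BetaPertH ⇐ (D1) ∧ (D4) ∧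
CAP+tail; G-an2-4 gates asym, D1 and NE2/3/4.»  HONEST FRAMING (cell contract, verbatim): «discharging `BetaPertH` makes Bałaban's UV stability
UNCONDITIONAL — a real constructive-QFT result; it is NOT the continuum limit and NOT the Clay problem.»  THIS MODULE DISCHARGES NOTHING of (K),
of D1 or of the wall: [folklore] linearity of `sortK` ∕ `periodiseF` ∕ `blocksHat` over finite families with summable image rows, re-indexing
`I d n p ≃ Fin (d+1) × Site (d+1) (n·p)` (`SortedReblocking.torusBlockEquiv`), and (B4) `PeriodicArraySuperposition.arr_vertexOfK` BY NAME.
No definition, no `def … : Prop`, nothing cited, 0 sorry.  0 root-level binders of row D1 discharged; (K) NOT closed; NOT D1, NOT `BetaPertH`,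
NOT continuum, NOT Clay.

ABSOLUTE RULE (cell charter, verbatim): «No internally-minted statement may enter as a cited fact. Every hypothesis is either kernel-proved in this
package or a verbatim quotation of a PUBLISHED theorem with page reference. The manuscript(s) under audit are NOT citable for their own disputed
steps — they are the thing under adjudication; programme-internal (2001/route/tribunal) claims are never citable.»

CONTENT (all [folklore]).
* §1 LINEARITY: `sortK_finset_sum` (definitional), `periodiseF_finset_sum` (given summable image rows), **`blocksHat_sortK_finset_sum`**.
* §2 `summable_images_arr` (the image rows of the array of a bi-localised kernel are summable — `PeriodicArrays.summable_abs_row_arr`).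
* §3 **`blocksHat_sortK_arr_vertexOfK`** — the displayed identity (weights `colH K`, hypothesis shape of (B4) `arr_vertexOfK`); the response
  `r k` is (B4b) `PackedResponseTorus.response_inl_eq_tsum_colH`'s right-hand side up to the choice of fine-bond representative (there `finePt`, here
  `windowMap ∘ torusBlockEquiv`; the two `m`-sums agree by a shift of `m` — (B3) does that bookkeeping where it instantiates).
Unit `b2b-balaban-beta-d1-p2` (road owner, gen 16), 2026-08-22.
-/

noncomputable section

namespace Summit.QuantumFields.BalabanUV.Beta.D1BFx.PeriodicArraySuperpositionTorus

open Matrix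
open scoped BigOperators
open Literature.Probability.LatticeModels (TorusSite)
open Literature.MathematicalPhysics.QuantumFieldTheory.Balaban1983to89
open Literature.MathematicalPhysics.QuantumFieldTheory.Balaban1983to89.Beta
open B12Sec2to5 (l1 l1_nonneg Decay510)
open ExpKernelCalculus (MKer BiLoc shiftK)
open OneStepResolventKernel (Fib LocStencil)
open OneStepKernelFamily (vertexOfK colH)
open Summit.QuantumFields.BalabanUV.Beta.D1BFx.FibredPeriodisation (FKer periodiseF periodiseF_apply Kfib)
open Summit.QuantumFields.BalabanUV.Beta.D1BFx.SortedKernels (blocksHat blocksHat_eq_reindex fTL fTR fBL fBR)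
open Summit.QuantumFields.BalabanUV.Beta.D1BFx.SortedReblocking (finePt reblock reblock_apply torusBlockEquiv finePt_imageShift)
open Summit.QuantumFields.BalabanUV.Beta.D1BFx.SortedPack (sortK sortK_apply sortK_inl_inl sortK_inl_inr sortK_inr_inl sortK_inr_inr ι)
open Summit.QuantumFields.BalabanUV.Beta.D1BFx.PeriodicArrays (arr toF summable_abs_row_arr)
open Summit.QuantumFields.BalabanUV.Beta.D1BFx.PeriodicArraySuperposition (arr_vertexOfK)

variable {d : ℕ} {n p : ℕ} [NeZero n] [NeZero p]

/-! ## §1 Linearity of the sorted periodisation over finite families -/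

section Linear

variable {ι' : Type*} (T : Finset ι') (c : ι' → ℝ)

omit [NeZero n] [NeZero p] in
/-- [folklore] A coarse image shift seen from the fine lattice: `n • (w + p·t) = n•w + (n·p)·t`. -/
theorem zsmul_imageShift (w t : Fin (d + 1) → ℤ) : (n : ℤ) • imageShift p w t = imageShift (n * p) ((n : ℤ) • w) t := by
  funext i; simp only [Pi.smul_apply, imageShift, smul_eq_mul, Nat.cast_mul]; ring

/-- [folklore] The fibrewise periodisation is linear over finite families whose image rows are summable (the family given through a
pointwise unfolding `hdef`, so that block read-outs of sorted packs match syntactically). -/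
theorem periodiseF_finset_sum {α β : Type*} {L : FKer (d + 1) α β} {Li : ι' → FKer (d + 1) α β}
    (hdef : ∀ I J, L I J = ∑ i ∈ T, c i * Li i I J)
    (hL : ∀ i ∈ T, ∀ (a : α) (b : β) (x w : Fin (d + 1) → ℤ), Summable fun t => Li i (x, a) (imageShift p w t, b))
    (x y : Beta.Site (d + 1) p) (a : α) (b : β) :
    periodiseF p L (x, a) (y, b) = ∑ i ∈ T, c i * periodiseF p (Li i) (x, a) (y, b) := by
  simp only [periodiseF_apply, periodise₂, Kfib, hdef]
  rw [Summable.tsum_finsetSum (fun i hi => (hL i hi a b _ _).mul_left (c i))]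
  exact Finset.sum_congr rfl fun i _ => tsum_mul_left

variable (K : ι' → MKer (d + 1) (Fib d))

omit [NeZero n] in
/-- [folklore] **THE SORTED TORUS MATRIX IS LINEAR over finite families of packs with summable fine image rows**:
`blocksHat p (sortK n (Σ_i c_i • K_i)) = Σ_i c_i • blocksHat p (sortK n K_i)` (block by block: `fTL ∕ fTR ∕ fBL ∕ fBR` of a sorted pack read the pack at
fine points `finePt n · ẑ` ∕ coarse points `n • ·`, whose coarse image shifts are fine image shifts — `finePt_imageShift`, `zsmul_imageShift`). -/
theorem blocksHat_sortK_finset_sum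
    (hK : ∀ i ∈ T, ∀ (a b : Fib d) (x w : Fin (d + 1) → ℤ), Summable fun t => K i x (imageShift (n * p) w t) a b) :
    blocksHat p (sortK n (fun x y a b => ∑ i ∈ T, c i * K i x y a b)) = ∑ i ∈ T, c i • blocksHat p (sortK n (K i)) := by
  ext I J
  rw [Matrix.sum_apply]
  simp only [Matrix.smul_apply, smul_eq_mul]
  rcases I with ⟨x, z, a⟩ | ⟨x, a⟩ <;> rcases J with ⟨y, z', b⟩ | ⟨y, b⟩ <;>
    simp only [blocksHat, Matrix.fromBlocks_apply₁₁, Matrix.fromBlocks_apply₁₂, Matrix.fromBlocks_apply₂₁, Matrix.fromBlocks_apply₂₂,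
      Matrix.of_apply]
  · refine periodiseF_finset_sum T c (Li := fun i => fTL (sortK n (K i))) (fun _ _ => rfl) ?_ x y (z, a) (z', b)
    rintro i hi ⟨z₁, a₁⟩ ⟨z₂, b₂⟩ x' w
    simp only [fTL, sortK_inl_inl, finePt_imageShift]
    exact hK i hi _ _ _ _
  · refine periodiseF_finset_sum T c (Li := fun i => fTR (sortK n (K i))) (fun _ _ => rfl) ?_ x y (z, a) b
    rintro i hi ⟨z₁, a₁⟩ b₂ x' w
    simp only [fTR, sortK_inl_inr, zsmul_imageShift]
    exact hK i hi _ _ _ _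
  · refine periodiseF_finset_sum T c (Li := fun i => fBL (sortK n (K i))) (fun _ _ => rfl) ?_ x y a (z', b)
    rintro i hi a₁ ⟨z₂, b₂⟩ x' w
    simp only [fBL, sortK_inr_inl, finePt_imageShift]
    exact hK i hi _ _ _ _
  · refine periodiseF_finset_sum T c (Li := fun i => fBR (sortK n (K i))) (fun _ _ => rfl) ?_ x y a b
    rintro i hi a₁ b₂ x' w
    simp only [fBR, sortK_inr_inr, zsmul_imageShift]
    exact hK i hi _ _ _ _

end Linear

/-! ## §2 The image rows of an array are summable -/

omit [NeZero n] in
/-- [folklore] The image rows `t ↦ arr s V x (w + s·t) a b` of the array of a bi-localised kernel are summable. -/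
theorem summable_images_arr {V : MKer (d + 1) (Fib d)} {P Q : Fin (d + 1) → ℤ} {C δ : ℝ} (hV : BiLoc V P Q C δ) (hδ : 0 < δ)
    (s : ℕ) [NeZero s] (a b : Fib d) (x w : Fin (d + 1) → ℤ) : Summable fun t => arr s V x (imageShift s w t) a b := by
  exact summable_row_imageShift (K := Kfib (toF (arr s V)) a b) (fun x => (summable_abs_row_arr hV hδ s a b x).of_abs) x w

/-! ## §3 The torus-matrix form of «PACKED-DICT» -/

section Hat

/-- [folklore] **«PACKED-DICT-HAT» — THE (A2-Mᴾ) DICTIONARY LETTER FOR RESPONSE-PACKED DATA IS A THEOREM.**  For a decaying packed resolvent `K`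
(`Decays K C δK`), a self-localised (`LocStencil S Cs δ`, `0 < δ ≤ δK`) fine-translation-covariant stencil family `S`, block side `n ≥ 1`, coarse period
`p ≥ 1` and coarse bond `(μ, ŷ)`:
`blocksHat p (sortK n (arr (n·p) (vertexOfK K n S μ ŷ))) = Σ_{k = (z̄, (ẑ, κ′)) : I d n p} (Σ'_m colH K n μ ŷ κ′ (ŵ_k + (n·p)·m)) • blocksHat p (sortK n (arr (n·p) (S κ′ ŵ_k)))`,
`ŵ_k := windowMap (n·p) (torusBlockEquiv n p (z̄, ẑ))` — the periodised sorted array of the packed first jet is the RESPONSE-WEIGHTED finite sum, over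
the torus' fine bonds, of the periodised sorted arrays of the single-bond stencils ((B4) `arr_vertexOfK` read through §1's linearity). -/
theorem blocksHat_sortK_arr_vertexOfK {K : MKer (d + 1) (Fib d)} {C δK : ℝ} (hK : ExpKernelCalculus.Decays K C δK) (hC : 0 ≤ C)
    {S : Fin (d + 1) → (Fin (d + 1) → ℤ) → MKer (d + 1) (Fib d)} {Cs δ : ℝ}
    (hS : LocStencil S Cs δ) (hδ : 0 < δ) (hδK : δ ≤ δK) (hScov : ∀ κ' u v, S κ' (u + v) = shiftK (-v) (S κ' u))
    (μ : Fin (d + 1)) (yhat : Fin (d + 1) → ℤ) :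
    blocksHat p (sortK n (arr (n * p) (vertexOfK K n S μ yhat)))
      = ∑ k : Beta.Site (d + 1) p × (TorusSite (d + 1) n × Fin (d + 1)),
          (∑' m : Fin (d + 1) → ℤ, colH K n μ yhat k.2.2 (imageShift (n * p) (windowMap (d + 1) (n * p) (torusBlockEquiv n p (k.1, k.2.1))) m))
            • blocksHat p (sortK n (arr (n * p) (S k.2.2 (windowMap (d + 1) (n * p) (torusBlockEquiv n p (k.1, k.2.1)))))) := by
  -- (B4) entrywise, re-indexed along `k ↦ (κ′, torusBlockEquiv (z̄, ẑ))`
  let e : Beta.Site (d + 1) p × (TorusSite (d + 1) n × Fin (d + 1)) ≃ Fin (d + 1) × Beta.Site (d + 1) (n * p) :=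
    { toFun := fun k => (k.2.2, torusBlockEquiv n p (k.1, k.2.1))
      invFun := fun q => (((torusBlockEquiv n p).symm q.2).1, (((torusBlockEquiv n p).symm q.2).2, q.1))
      left_inv := fun k => by simp
      right_inv := fun q => by simp }
  have hB4 : arr (n * p) (vertexOfK K n S μ yhat) = fun x z a b =>
      ∑ k : Beta.Site (d + 1) p × (TorusSite (d + 1) n × Fin (d + 1)),
        (∑' m : Fin (d + 1) → ℤ, colH K n μ yhat k.2.2 (imageShift (n * p) (windowMap (d + 1) (n * p) (torusBlockEquiv n p (k.1, k.2.1))) m))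
          * arr (n * p) (S k.2.2 (windowMap (d + 1) (n * p) (torusBlockEquiv n p (k.1, k.2.1)))) x z a b := by
    funext x z a b
    rw [arr_vertexOfK (n := n) hK hC hS hδ hδK hScov (n * p) μ yhat x z a b, ← Fintype.sum_prod_type']
    -- `Σ_{(κ′, zz)} = Σ_k` along `e`
    exact (Fintype.sum_equiv e _ (fun q : Fin (d + 1) × Beta.Site (d + 1) (n * p) =>
      (∑' m : Fin (d + 1) → ℤ, colH K n μ yhat q.1 (imageShift (n * p) (windowMap (d + 1) (n * p) q.2) m))
        * arr (n * p) (S q.1 (windowMap (d + 1) (n * p) q.2)) x z a b) (fun k => rfl)).symm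
  rw [hB4]
  exact blocksHat_sortK_finset_sum Finset.univ _ _ fun k _ a b x w =>
    summable_images_arr (hS k.2.2 _) hδ (n * p) a b x w

end Hat

end Summit.QuantumFields.BalabanUV.Beta.D1BFx.PeriodicArraySuperpositionTorus

end
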